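import Mathlib.Algebra.Module.LinearMap.Defs
import Mathlib.Data.Complex.Basic
import Mathlib.Data.Real.Basic
import Mathlib.Order.ConditionallyCompleteLattice.Basic
import Mathlib.Tactic
import HarnessLib

/-!
# Hintz 2026 ↔ [AF] on the SPECTRAL side: the normal-operator conjugation (EqipMeroHi) = [AF] (10.7), and the
# weight dictionaries behind three equation-level citations (bookkeeping only; HINTZ-PLAN P32)

CITATION HEADER (lean-in-tree rule 2026-08-18).  P. Hintz, *Nonlinear stability of subextremal Kerr black
holes*, arXiv:2606.28253 **v2** (2026-08-03), bib key `Hintz2026` — an UNREFEREED CLAIM under adjudication in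
this library; TeX line numbers `H l.N` refer to the v2 source `kerr-stab-r.tex`.  Its companion [AF] = P. Hintz,
*(Non-)Linear waves on asymptotically flat spacetimes. II*, arXiv:2606.28008 **v1** (2026), bib key
`Hintz2026WavesII`, equally UNREFEREED; `AF l.N` = line of its e-print `nonstat2.tex`, printed numbers = public
v1 PDF.  This module belongs to the audit cell `pub-kerr`'s HINTZ-PLAN P32 (the equation- and item-level `\citeAF`
citations of Hintz v2 read at statement level; table `EQ-ROWS.md` of that cell).  It records, as kernel-checked
BOOKKEEPING, the four places of that pass where a use site carries arithmetic rather than a mere pointer: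

* §1 (`conjNsf_eq_hintzNh`, `hintzNh_eq_afNip0`).  Hintz eq. (EqipMeroHi) (H l.8372): "For `R ≤ ½` we compute …
  `N_h = −2R⁻¹(R∂_R + λ)(R∂_R + 1 + S̲) + R⁻²L̲̃(0)(ω,−R∂_R,∂_ω)`, which is equal to the operator `N⁰_{ι⁺}(P₀,−iλ)`
  in the notation of [AF, (10.7)]", where `N_h := R̃^{−λ}R̃⁻²N_sf(λ)R̃^{λ}` (H l.8368) and
  `N_sf(λ) := −2∂_v(v∂_v + λ − 1 − S̲) + L̲̃(0)(ω, v∂_v + λ, ∂_ω)` (H l.8238), `v = 1/R`; [AF] (10.7) (AF l.9784):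
  `N⁰_{ι⁺}(P₀,σ) := −2R⁻¹(iσ + R∂_R)(R∂_R + 1 + S|_{∂X}) + R⁻²P_{(0)}(0,ω,−R∂_R,∂_ω)`.  MODEL: operators in the
  radial variable built from powers `R^c`, the Euler field `E = R∂_R` and "angular" coefficients (the endomorphism
  `S̲` and the three coefficients `Q₀, Q₁, Q₂` of the abstract quadratic `L̲̃(0)(ω,D,∂_ω) = Q₀ + Q₁D + Q₂D²`) are
  realised on the MELLIN SIDE: a function `u : 𝕜 → M` stands for the formal superposition `Σ_μ R^μ u(μ)` with
  values in a `𝕜`-module `M` on which the angular coefficients act as (NON-commuting) `𝕜`-linear maps; then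
  `(R^c u)(μ) = u(μ − c)`, `(E u)(μ) = μ • u(μ)`, and in the variable `v = 1/R` (`v^ν = R^{−ν}`):
  `(v∂_v w)(ν) = ν • w(ν)`, `(∂_v w)(ν) = (ν+1) • w(ν+1)`.  In this model the CONJUGATION IDENTITY
  `R⁻²R^{−λ}(N_sf(λ) in the variable 1/R)R^{λ} = N_h` is a theorem (`conjNsf_eq_hintzNh`), and `N_h` is literally
  [AF] (10.7) at `iσ = λ` (`hintzNh_eq_afNip0`, with `I * (−I * λ) = λ`, `spectral_param`).  The model captures
  exactly the non-commutative bookkeeping (shifts, Euler weights, order of the angular factors) in which such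
  identities are checked by hand; it does not, of course, know what `L̲̃(0)` is.
* §1b (`lhatLead_eq_sq_smul_ntf`).  Hintz's OWN normalisation of the tf-normal operator, eq. (EqIGenKNtf)
  (H l.1593–1597): for `L̂(σ) = 2iσρ(ρ∂_ρ − 1 − S) + ρ²L̃(0)(ρ,ω,ρ∂_ρ,∂_ω)`, "to leading order at tf, and for
  `r̂ := ∣σ∣/ρ`, we have `∣σ∣^{−2}L̂(σ) ≡ −2iσ̂r̂⁻¹(r̂∂_{r̂} + 1 + S) + r̂⁻²L̃(0)(0,ω,−r̂∂_{r̂},∂_ω) =: N_tf(L,σ̂)`,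
  `σ̂ := σ/∣σ∣`".  In the Mellin model of the variable `r̂` (`ρ = ∣σ∣·r̂⁻¹`, `ρ∂_ρ = −r̂∂_{r̂}`), with the first slot
  of `L̃(0)` frozen at `ρ = 0` (the printed "leading order"), the identity `L̂(σ) = ∣σ∣² · N_tf(L,σ̂)` holds EXACTLY
  given `iσ = ∣σ∣·(iσ̂)` — i.e. the power of `∣σ∣` relating `L̂(σ)` and `N_tf` is `+2`, from Hintz's own display.
* §2 (`sigmaPow_solves_iff`, `tfEquiv_chain`).  [AF] (3.32) (AF l.3061) `H^{s,(r,l,q)}_{scbt,σ} =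
  ρ_scf^r ρ_tf^l ρ_zf^q H^s_{scbt,σ}` and `σ ≍ ρ_tf ρ_zf` on `X_scbt` (σ vanishes simply exactly on tf ∪ zf) give:
  `σ^m w ∈ H^{(r,l,q)} ⇔ w ∈ H^{(r,l−m,q−m)}`.  Hintz's display H l.6286 asserts
  `‖N(χu)‖_{(𝗌−1,(r+1,α,−η−2))} ∼ ‖∣σ∣^{−2}N(χu)‖_{(𝗌−1,(r+1,α+2,−η))}`; the weight equation has the UNIQUE
  solution `m = +2` (`sigmaPow_solves_iff`), which is [AF] (9.122)'s `ς²N_tf` (AF l.9663) and [AF]'s own chain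
  AF l.9657–9659 — the cell's NIL datum SRC-A34 ("∣σ∣^{−2}" printed twice for "∣σ∣^{+2}"; the step's conclusion
  H l.6290 is unaffected).  `tfEquiv_chain` is the exponent bookkeeping of [AF] (3.46)'s tf-equivalence
  (`∼ ∣σ∣^{3/2−l}`, AF l.3222) along that chain.
* §3 (`zeroEnergyWeight_iff`, `sSup_gap`).  Hintz (EqWEMode0) (H l.7835) is stated on the UNWEIGHTED b-density
  `μ_b` with `α ∈ (0,ε_ind)`; [AF] Thm 9.36 (AF l.9421) on the Euclidean density with "`α + 3/2` in an indicial gap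
  `I`"; Hintz's footnote at H l.7850 gives the dictionary `α_{μ_b} = α_{Eucl} + 3/2`.  Under it the two hypotheses
  coincide, and [AF] Thm 9.36(2) ("`u ∈ 𝒜^β` for all `β < sup I`") yields the class `𝒜^{ε_ind−ε}` printed at
  H l.7863 (where the text cites the nonzero-frequency item [AF] Thm 9.5(5) "cf." — the cell's NIL datum SRC-A33).
* §4 (`af1330a_inst_*`).  [AF] (13.30a) (AF l.12084): the sc-b-transition norm with orders `(r+α₊+1, α_tf+2, 0)`
  (density `μ`) is bounded by the b-norm with weights `(r̄_o+α₊+5/2+ε, α_tf+7/2, 0)` (density `μ_b`) — i.e. a known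
  b-bound with weights `(a,b)` delivers every target whose scf-order `T_scf` and tf-order `T_tf` satisfy
  `T_scf + 3/2 + ε ≤ a`, `T_tf + 3/2 ≤ b`.  Hintz's three instances (H l.10093 with source `(3−ε,2+ε_ind−ε)`, its
  `2−ε` variant, H l.10585 with source `(1−ε,1−2ε)`) and the conditions he prints ("`α_sf < −3/2+ε_ind`",
  "`r + α_sf < ½`", "`r + α_sf < −½`", "`r < −½`") are checked.
* §5 (`kerClass_*`, `thr_*`).  The constants of [AF] Thm 9.38(5) / Thm 9.5(5) / (9.16b)–(9.16c) at Hintz's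
  values `n = 3`, `S̲ = ϑ_in = ϑ_out = 0` (H l.6131: "the quantities ϑ_{∂𝒦⁺,in}, ϑ_{∂𝒦⁺,out}, S̲ vanish since the
  Minkowskian 1-form wave operator is symmetric"): kernel class exponent `(n−1)/2 + S̲ = 1` (H l.7697 "improves the
  decay rate α to 1−ε"), thresholds `r + α₊ > −½` (in) / `< −½` (out) (H l.6240, 7697, 10585).

Nothing here asserts an estimate, a Fredholm property or a normal-operator COMPUTATION for an actual differential
operator; no named facts (D-0026): every `def` is a transcription with arguments, every theorem is proved.
Companions: `Hintz2026/ForwardSolutionDictionary.lean` (the 𝒥⁺-side dictionaries, [AF] Thm 11.1 / Def 5.18),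
`Hintz2026/ExteriorNormalOperator.lean`.

## References
* P. Hintz, arXiv:2606.28253v2 (2026): (EqIGenKNtf) l.1596; Prop `PropWGMode` proof Step (1.2.3) l.6282–6290;
  (EqWGMode0Map) l.6151; (EqWEMode0) + fn. l.7835–7850; l.7863; N_sf(λ) l.8238; (EqipMeroHi) l.8362–8375;
  (EqAdmLoImfHb2) l.10086–10093; l.10585; l.6131, 6240, 7697. [Hintz2026]
* P. Hintz, arXiv:2606.28008v1 (2026): (3.32) l.3061, (3.46) l.3220–3224, Thm 9.5(5) l.8003, (9.16b,c) l.7970–7973,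
  Thm 9.36 l.9421–9441, Thm 9.38 l.9482–9513, (9.122) l.9663, Def 10.2 (10.7) l.9784–9788, (13.30a) l.12084–12087.
  [Hintz2026WavesII]
-/

namespace Literature.Geometry.Lorentzian

namespace Hintz2026.SpectralSideDictionary

/-! ## §1 The Mellin-side model and the conjugation identity (EqipMeroHi) = [AF] (10.7) -/

section MellinModel

variable {𝕜 : Type*} [Field 𝕜] {M : Type*} [AddCommGroup M] [Module 𝕜 M]

/-- Multiplication by `R^c` on the Mellin side: `R^c · Σ R^μ u(μ) = Σ R^μ u(μ − c)`.  (Model definition; the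
operators it is applied to are Hintz 2026's `N_h`, `N_sf(λ)` and [AF] (10.7).)
[cite: Hintz2026, eq. (EqipMeroHi) TeX l.8362-8375 (model of the radial calculus used there; claim under review)] -/
def powR (c : 𝕜) (u : 𝕜 → M) : 𝕜 → M := fun μ => u (μ - c)

/-- The Euler field `E = R∂_R` on the Mellin side: `(E u)(μ) = μ • u(μ)` (`R∂_R R^μ = μR^μ`).
[cite: Hintz2026, eq. (EqipMeroHi) TeX l.8362-8375 (model; claim under review)] -/
def eulerR (u : 𝕜 → M) : 𝕜 → M := fun μ => μ • u μ

/-- `∂_v = v⁻¹(v∂_v)` on the Mellin side of the variable `v` (`w(ν) ↔ v^ν`): `∂_v v^ν = ν v^{ν−1}`, so the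
coefficient of `v^ν` in `∂_v w` is `(ν+1) • w(ν+1)`.
[cite: Hintz2026, definition of N_sf(λ) TeX l.8238 (model; claim under review)] -/
def dv (w : 𝕜 → M) : 𝕜 → M := fun ν => (ν + 1) • w (ν + 1)

/-- The shifted Euler field `D = v∂_v + λ`: `(D w)(ν) = (ν + λ) • w(ν)`.
[cite: Hintz2026, definition of N_sf(λ) TeX l.8238 (model; claim under review)] -/
def shiftedEulerV (lam : 𝕜) (w : 𝕜 → M) : 𝕜 → M := fun ν => (ν + lam) • w ν

/-- The abstract quadratic `Q(D) = Q₀ + Q₁ D + Q₂ D²` standing for `L̲̃(0)(ω, D, ∂_ω)` (Hintz) =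
`P_{(0)}(0, ω, D, ∂_ω)` ([AF]): three NON-commuting angular coefficients applied after `0, 1, 2` powers of `D`.
[cite: Hintz2026WavesII, Def 10.2 eq. (10.6)-(10.7) TeX l.9776-9788 (model; claim under review)] -/
def quadOp (Q₀ Q₁ Q₂ : M →ₗ[𝕜] M) (D : (𝕜 → M) → (𝕜 → M)) (u : 𝕜 → M) : 𝕜 → M :=
  fun μ => Q₀ (u μ) + Q₁ (D u μ) + Q₂ (D (D u) μ)

/-- The change of variable `v = 1/R` on the Mellin side: `v^ν = R^{−ν}`, so `(toV u)(ν) = u(−ν)`.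
[cite: Hintz2026, TeX l.8368-8375 ("For R ≥ 1 (so v ≤ 1) …"; model; claim under review)] -/
def toV (u : 𝕜 → M) : 𝕜 → M := fun ν => u (-ν)

/-- Inverse change of variable `R = 1/v`: `(toR w)(μ) = w(−μ)`.
[cite: Hintz2026, TeX l.8368-8375 (model; claim under review)] -/
def toR (w : 𝕜 → M) : 𝕜 → M := fun μ => w (-μ)

/-- **[AF] (10.7)**, the `ι⁺`-normal operator family, with `s := iσ`:
`N⁰_{ι⁺}(P₀,σ) = −2R⁻¹(iσ + R∂_R)(R∂_R + 1 + S|_{∂X}) + R⁻²P_{(0)}(0,ω,−R∂_R,∂_ω)` (operators applied right to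
left: first `R∂_R + 1 + S`, then `iσ + R∂_R`, then `R⁻¹`).
[cite: Hintz2026WavesII, Def 10.2 eq. (10.7) TeX l.9784-9788 (transcription; claim under review)] -/
def afNip0 (s : 𝕜) (S Q₀ Q₁ Q₂ : M →ₗ[𝕜] M) (u : 𝕜 → M) : 𝕜 → M :=
  fun μ => (-2 : 𝕜) • powR (-1) (fun m => (s + m) • ((m + 1) • u m + S (u m))) μ
    + powR (-2) (quadOp Q₀ Q₁ Q₂ (fun w m => -(m • w m)) u) μ

/-- **Hintz 2026 eq. (EqipMeroHi)** (H l.8372):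
`N_h = −2R⁻¹(R∂_R + λ)(R∂_R + 1 + S̲) + R⁻²L̲̃(0)(ω,−R∂_R,∂_ω)` for `R ≤ ½`.
[cite: Hintz2026, eq. (EqipMeroHi) TeX l.8370-8374 (transcription; claim under review)] -/
def hintzNh (lam : 𝕜) (S Q₀ Q₁ Q₂ : M →ₗ[𝕜] M) (u : 𝕜 → M) : 𝕜 → M :=
  fun μ => (-2 : 𝕜) • powR (-1) (fun m => (m + lam) • ((m + 1) • u m + S (u m))) μ
    + powR (-2) (quadOp Q₀ Q₁ Q₂ (fun w m => -(m • w m)) u) μ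

/-- **Hintz 2026, `N_sf(λ)`** (H l.8238):
`N_sf(λ) := N(2ρ⁻²L̲, ρ^λ) := −2∂_v(v∂_v + λ − 1 − S̲) + L̲̃(0)(ω, v∂_v + λ, ∂_ω)`, in the variable `v`.
[cite: Hintz2026, TeX l.8238 (transcription; claim under review)] -/
def hintzNsf (lam : 𝕜) (S Q₀ Q₁ Q₂ : M →ₗ[𝕜] M) (w : 𝕜 → M) : 𝕜 → M :=
  fun ν => (-2 : 𝕜) • dv (fun n => (n + lam - 1) • w n - S (w n)) ν
    + quadOp Q₀ Q₁ Q₂ (shiftedEulerV lam) w ν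

/-- **Hintz's `N_h := R̃^{−λ}R̃⁻²N_sf(λ)R̃^{λ}`** (H l.8368) in the region `R ≤ ½` where `R̃ = R`, with `N_sf(λ)`
acting in the variable `v = 1/R`: conjugate `N_sf` by the change of variable, then by `R^λ`, then multiply by `R⁻²`
(`R^{−λ}` and `R⁻²` commute).
[cite: Hintz2026, TeX l.8362-8372 (transcription; claim under review)] -/
def conjNsf (lam : 𝕜) (S Q₀ Q₁ Q₂ : M →ₗ[𝕜] M) (u : 𝕜 → M) : 𝕜 → M :=
  powR (-2) (powR (-lam) (toR (hintzNsf lam S Q₀ Q₁ Q₂ (toV (powR lam u)))))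

/-- **The conjugation identity behind (EqipMeroHi)** ("we compute using (EqipSpecFam) that N_h = …", H l.8370):
in the Mellin model, `R⁻²R^{−λ}·(N_sf(λ) in v = 1/R)·R^{λ}` IS `−2R⁻¹(R∂_R + λ)(R∂_R + 1 + S̲) + R⁻²L̲̃(0)(ω,−R∂_R,∂_ω)`
— for every scalar field `𝕜`, every `𝕜`-module of angular data, all (non-commuting) `S̲, Q₀, Q₁, Q₂`, all `λ`.
Hand version (cell table EQ-ROWS E29): `v∂_v = −R∂_R`, `∂_v = −R·R∂_R`, `R^{−λ}(R∂_R)R^{λ} = R∂_R + λ`.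
[cite: Hintz2026, eq. (EqipMeroHi) TeX l.8362-8375 (identity checked; claim under review)] -/
theorem conjNsf_eq_hintzNh (lam : 𝕜) (S Q₀ Q₁ Q₂ : M →ₗ[𝕜] M) :
    conjNsf lam S Q₀ Q₁ Q₂ = hintzNh lam S Q₀ Q₁ Q₂ := by
  funext u μ
  simp only [conjNsf, hintzNh, hintzNsf, powR, toR, toV, dv, shiftedEulerV, quadOp]
  ring_nf
  simp only [map_smul, map_neg, smul_neg, neg_neg]
  module

/-- **"… which is equal to the operator `N⁰_{ι⁺}(P₀,−iλ)` in the notation of [AF, (10.7)]"** (H l.8375): with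
`s = iσ` and `σ = −iλ`, i.e. `s = λ` (`spectral_param`), Hintz's (EqipMeroHi) and [AF] (10.7) are the same
operator in the model (the only difference in print is the order of the summands `λ + R∂_R` / `R∂_R + λ`).
[cite: Hintz2026, TeX l.8375; Hintz2026WavesII, eq. (10.7) TeX l.9784-9788 (claim under review)] -/
theorem hintzNh_eq_afNip0 (lam : 𝕜) (S Q₀ Q₁ Q₂ : M →ₗ[𝕜] M) :
    hintzNh lam S Q₀ Q₁ Q₂ = afNip0 lam S Q₀ Q₁ Q₂ := by
  funext u μ
  simp only [hintzNh, afNip0, add_comm lam]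

/-- The spectral-parameter dictionary `σ = −iλ` of H l.8290 / l.8375 ("in the notation of [AF]: `−Im σ`, under the
identification `σ = −iλ`"): then [AF]'s `iσ` is Hintz's `λ`.
[cite: Hintz2026, TeX l.8290 and l.8375 (claim under review)] -/
theorem spectral_param (lam : ℂ) : Complex.I * (-Complex.I * lam) = lam := by
  rw [neg_mul, mul_neg, ← mul_assoc, Complex.I_mul_I]
  ring

/-! ### §1b Hintz's own normalisation (EqIGenKNtf): `L̂(σ) = ∣σ∣² N_tf(L,σ̂)` to leading order at tf -/

/-- **Hintz 2026 eq. (EqIGenKNtf), right-hand side** (H l.1596):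
`N_tf(L,σ̂) := −2iσ̂ r̂⁻¹(r̂∂_{r̂} + 1 + S) + r̂⁻²L̃(0)(0,ω,−r̂∂_{r̂},∂_ω)`, on the Mellin side of the variable `r̂`
(`f(κ) ↔ r̂^κ`; `r̂⁻¹` shifts `κ ↦ κ+1`; `ish` stands for the scalar `iσ̂`).
[cite: Hintz2026, eq. (EqIGenKNtf) TeX l.1593-1597 (transcription; claim under review)] -/
def hintzNtf (ish : 𝕜) (S Q₀ Q₁ Q₂ : M →ₗ[𝕜] M) (f : 𝕜 → M) : 𝕜 → M :=
  fun κ => (-2 : 𝕜) • ish • powR (-1) (fun k => (k + 1) • f k + S (f k)) κ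
    + powR (-2) (quadOp Q₀ Q₁ Q₂ (fun w k => -(k • w k)) f) κ

/-- **Hintz 2026 eq. (EqIGenKNtf), left-hand side** (H l.1593): the spectral family
`L̂(σ) = 2iσρ(ρ∂_ρ − 1 − S) + ρ²L̃(0)(ρ,ω,ρ∂_ρ,∂_ω)` with `L̃(0)`'s first slot frozen at `ρ = 0` (the printed
"to leading order at tf"), written in the variable `r̂ = ∣σ∣/ρ`: multiplication by `ρ = ∣σ∣·r̂⁻¹` is
`f ↦ (κ ↦ ∣σ∣ • f(κ+1))`, and `ρ∂_ρ = −r̂∂_{r̂}` is `f ↦ (κ ↦ −κ • f κ)`; `is` stands for `iσ`, `a` for `∣σ∣`.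
[cite: Hintz2026, eq. (EqIGenKNtf) TeX l.1593-1597 (transcription in the variable r̂; claim under review)] -/
def lhatLead (is a : 𝕜) (S Q₀ Q₁ Q₂ : M →ₗ[𝕜] M) (f : 𝕜 → M) : 𝕜 → M :=
  fun κ => (2 : 𝕜) • is • a • powR (-1) (fun k => (-k - 1) • f k - S (f k)) κ
    + a • a • powR (-2) (quadOp Q₀ Q₁ Q₂ (fun w k => -(k • w k)) f) κ

/-- **The exponent is `+2`.**  With `iσ = ∣σ∣·iσ̂` (i.e. `σ̂ = σ/∣σ∣`), Hintz's (EqIGenKNtf) holds in the model as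
the EXACT identity `L̂(σ) = ∣σ∣² · N_tf(L,σ̂)` (leading order at tf) — for all non-commuting `S, Q₀, Q₁, Q₂`.  Hence
`L̂(σ) − ∣σ∣^{+2}N_tf(L,σ̂)` is the lower-order difference, as in [AF] (9.122) (`P̂₀(σ) − ς²N_tf ∈ ρ_scf ρ_tf³Diff²`);
the "∣σ∣^{−2}N_tf" of H l.6286/6288 is a slip (cell datum SRC-A34, NIL).
[cite: Hintz2026, eq. (EqIGenKNtf) TeX l.1593-1597 and TeX l.6286-6288; Hintz2026WavesII, eq. (9.122) TeX l.9663-9665 (claim under review)] -/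
theorem lhatLead_eq_sq_smul_ntf (is a ish : 𝕜) (h : is = a * ish) (S Q₀ Q₁ Q₂ : M →ₗ[𝕜] M) (f : 𝕜 → M) :
    lhatLead is a S Q₀ Q₁ Q₂ f = fun κ => (a * a) • hintzNtf ish S Q₀ Q₁ Q₂ f κ := by
  subst h
  funext κ
  simp only [lhatLead, hintzNtf, powR, quadOp]
  ring_nf
  simp only [map_smul, map_neg, smul_neg, neg_neg, smul_add, smul_sub, smul_smul]
  module

end MellinModel

/-! ## §2 sc-b-transition weights: which power of `σ` the display H l.6286 needs (SRC-A34) -/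

/-- Decay orders `(r, l, q)` of the sc-b-transition Sobolev space `H^{s,(r,l,q)}_{scbt,σ} = ρ_scf^r ρ_tf^l ρ_zf^q
H^s_{scbt,σ}` at the three faces scf, tf, zf ([AF] (3.32)); the regularity order `s` plays no role here.
[cite: Hintz2026WavesII, eq. (3.32) TeX l.3061 (transcription; claim under review)] -/
structure ScbtOrders where
  /-- decay order at the scattering face scf -/
  r : ℚ
  /-- decay order at the transition face tf -/
  l : ℚ
  /-- decay order at the zero face zf -/
  q : ℚ
  deriving DecidableEq, Repr

/-- Membership bookkeeping for multiplication by `σ^m`: since `σ ≍ ρ_tf ρ_zf` on `X_scbt` (σ is a product of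
defining functions of exactly tf and zf, cf. [AF] (3.45)'s `N_zf`, `N_tf` and Hintz l.10339 "`σρ = ρ_scf ρ_tf²`"
away from zf), `σ^m w ∈ H^{(r,l,q)} ⇔ w ∈ H^{(r, l−m, q−m)}`; `sigmaPow m o` = the orders of `w` when `σ^m w` has
orders `o`. [cite: Hintz2026WavesII, eq. (3.32) TeX l.3061 and (3.45)-(3.46) l.3212-3224 (bookkeeping; claim under review)] -/
def sigmaPow (m : ℚ) (o : ScbtOrders) : ScbtOrders := ⟨o.r, o.l - m, o.q - m⟩

/-- **SRC-A34 made arithmetic.**  The last equivalence of Hintz's display H l.6286,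
`‖N(χ_tf u)‖_{(𝗌−1,(r+1, α, −η−2))} ∼ ‖σ^m N(χ_tf u)‖_{(𝗌−1,(r+1, α+2, −η))}`, holds in the weight bookkeeping
iff `m = 2` — [AF] (9.122) / AF l.9659 print `ς²N_tf` (`ς = ∣σ∣`), Hintz prints `∣σ∣^{−2}N_tf` (twice, l.6286 and
l.6288); with `m = −2` the right member would have orders `(r+1, α+4, −η+2)`.
[cite: Hintz2026, TeX l.6282-6290; Hintz2026WavesII, eq. (9.122) TeX l.9663-9665 and l.9657-9659 (claim under review)] -/
theorem sigmaPow_solves_iff (m r α η : ℚ) :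
    sigmaPow m ⟨r + 1, α + 2, -η⟩ = ⟨r + 1, α, -η - 2⟩ ↔ m = 2 := by
  constructor
  · intro h
    have hl := congrArg ScbtOrders.l h
    simp only [sigmaPow] at hl
    linarith
  · rintro rfl
    simp [sigmaPow]

/-- With Hintz's printed exponent `m = −2` the orders do NOT match (the tf-order would be `α + 4`, the zf-order
`−η + 2`). [cite: Hintz2026, TeX l.6286-6288 (claim under review; cell datum SRC-A34, NIL)] -/
theorem sigmaPow_neg_two_ne (r α η : ℚ) :
    sigmaPow (-2) ⟨r + 1, α + 2, -η⟩ ≠ ⟨r + 1, α, -η - 2⟩ := by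
  intro h
  have := (sigmaPow_solves_iff (-2) r α η).mp h
  norm_num at this

/-- The exponent of `∣σ∣` in [AF] (3.46)'s tf-localised norm equivalence
`‖χ_tf u‖_{H^{s,(r,l,q)}_{scbt,σ}} ∼ ∣σ∣^{3/2 − l}‖χ_tf u‖_{H^{s,(r,q−l)}_{sc,b}(tf)}` (the `3/2` "arises from …
`r²∣dr dg̸∣ = (∣σ∣^{3/2})² r̂²∣dr̂ dg̸∣`", AF l.3224). [cite: Hintz2026WavesII, eq. (3.46) TeX l.3220-3224 (transcription; claim under review)] -/
def tfEquivExp (l : ℚ) : ℚ := 3 / 2 - l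

/-- Consistency of the chain H l.6284–6286 = AF l.9657–9659 with `m = +2`: going from tf-order `l = α` (first
member, factor `∣σ∣^{3/2−α}`) to tf-order `α + 2` (last member) costs exactly the factor `σ²` absorbed into the
operator: `3/2 − α = (3/2 − (α+2)) + 2`; and the sc,b-side orders agree: `q − l = (−η) − (α+2) = (−η−2) − α`.
[cite: Hintz2026WavesII, TeX l.9657-9659; Hintz2026, TeX l.6284-6286 (bookkeeping; claim under review)] -/
theorem tfEquiv_chain (α η : ℚ) :
    tfEquivExp α = tfEquivExp (α + 2) + 2 ∧ (-η) - (α + 2) = (-η - 2) - α := by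
  constructor
  · simp only [tfEquivExp]; ring
  · ring

/-! ## §3 The density dictionary behind (EqWEMode0) ↔ [AF] Thm 9.36 (SRC-A33) -/

/-- Hintz's density dictionary (footnote at H l.7850): a b-Sobolev decay order `α` measured with the unweighted
b-density `μ_b` equals the order measured with the Euclidean / metric density plus `3/2`
(`H̄_b^{s,α+2}(X,μ_b) = H̄_b^{s,α+1/2}(X,∣dg_b∣_X)`); `alphaMuB αE` = the `μ_b`-order of Euclidean order `αE`.
[cite: Hintz2026, footnote at TeX l.7850 (transcription; claim under review)] -/
def alphaMuB (αE : ℚ) : ℚ := αE + 3 / 2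

/-- The footnote's own instance: Euclidean order `α + 1/2` is `μ_b`-order `α + 2`.
[cite: Hintz2026, footnote at TeX l.7850 (claim under review)] -/
theorem alphaMuB_footnote (α : ℚ) : alphaMuB (α + 1 / 2) = α + 2 := by
  simp only [alphaMuB]; ring

/-- **(EqWEMode0)'s hypothesis IS [AF] Thm 9.36's.**  Hintz states the zero-energy map `L̂_b(0)` on `μ_b`-spaces
with "`α ∈ (0, ε_ind)`" (H l.7835–7845); [AF] Thm 9.36 asks, on Euclidean spaces, that "`α + 3/2` lies in an
indicial gap `I`" (AF l.9423), here `I = (0, ε_ind)` (Hintz Lemma 8.4).  Under the dictionary the two coincide.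
[cite: Hintz2026, eq. (EqWEMode0) TeX l.7835-7845; Hintz2026WavesII, Thm 9.36 TeX l.9421-9423 (claim under review)] -/
theorem zeroEnergyWeight_iff (αE εind : ℚ) :
    alphaMuB αE ∈ Set.Ioo 0 εind ↔ αE + 3 / 2 ∈ Set.Ioo 0 εind :=
  Iff.rfl

/-- **[AF] Thm 9.36(2)'s output at `I = (0, ε_ind)`**: "`u ∈ 𝒜^β(X)` for all `β < sup I`" with `sup (0,ε_ind) =
ε_ind` (for `ε_ind > 0`) — i.e. the class `𝒜^{ε_ind − ε}` (all `ε > 0`) printed at H l.7863, where the text cites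
the nonzero-frequency item [AF] Thm 9.5(5) "cf." (class `𝒜^{1+S̲−ε}`); cell datum SRC-A33 (NIL).
[cite: Hintz2026WavesII, Thm 9.36(2) TeX l.9439; Hintz2026, TeX l.7863 (claim under review)] -/
theorem sSup_gap {εind : ℝ} (h : 0 < εind) : sSup (Set.Ioo (0 : ℝ) εind) = εind :=
  csSup_Ioo h

/-- Every `β = ε_ind − ε` with `0 < ε < ε_ind` is below `sup I`, hence an admissible conormal order by Thm 9.36(2).
[cite: Hintz2026WavesII, Thm 9.36(2) TeX l.9439; Hintz2026, TeX l.7863 (claim under review)] -/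
theorem gap_class (εind ε : ℝ) (hε : 0 < ε) : εind - ε < εind := by linarith

/-! ## §4 [AF] (13.30a) at Hintz's three use sites (EQ-ROWS E31) -/

/-- **[AF] (13.30a) as a weight-transfer rule.**  `‖u‖_{H̄^{(𝗌−1;k),(T_scf, T_tf, 0)}_{(scbt,∣σ∣);b}(X,μ)} ≤
C‖u‖_{H̄^{k+ℓ,(T_scf + 3/2 + ε, T_tf + 3/2, 0)}_{b,∣σ∣}(X,μ_b)}` (printed with `T_scf = r+α₊+1`, `T_tf = α_tf+2`, source
weights `r̄_o+α₊+5/2+ε` and `α_tf+7/2`; "the shift of 3/2 … is due to the passage from μ to μ_b", AF l.12087).  Hence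
a KNOWN uniform b-bound with weights `(a, b)` yields the target orders `(T_scf, T_tf)` whenever, for some `ε > 0`,
`T_scf + 3/2 + ε ≤ a` and `T_tf + 3/2 ≤ b` (weighted norms are monotone in the weights).
[cite: Hintz2026WavesII, Cor 13.17 ff. eq. (13.30a) TeX l.12081-12087 (transcription; claim under review)] -/
def af1330aDelivers (a b Tscf Ttf : ℚ) : Prop :=
  ∃ ε : ℚ, 0 < ε ∧ Tscf + 3 / 2 + ε ≤ a ∧ Ttf + 3 / 2 ≤ b

/-- **Instance 1 (H l.10091–10093).**  Source `(EqAdmLoImfHb2)` = `H^{k,(3−ε₀, 2+ε_ind−ε₀, 0)}_{b,ς}(X,μ_b)`; target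
orders `(r + α_sf + 1, α_sf + 2)`.  Hintz: "for all `α_sf < (2+ε_ind−ε₀) − 7/2` … under the sole assumption that
at the zero section … `r + α_sf + 1 < 3/2 − ε₀`, i.e. `r + α_sf < ½`" — these printed conditions deliver the target.
[cite: Hintz2026, TeX l.10086-10093; Hintz2026WavesII, eq. (13.30a) TeX l.12084 (claim under review)] -/
theorem af1330a_inst_10093 (ε₀ εind r αsf : ℚ)
    (htf : αsf < (2 + εind - ε₀) - 7 / 2) (hscf : r + αsf + 1 < 3 / 2 - ε₀) :
    af1330aDelivers (3 - ε₀) (2 + εind - ε₀) (r + αsf + 1) (αsf + 2) := by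
  refine ⟨(3 / 2 - ε₀ - (r + αsf + 1)) / 2, by linarith, by linarith, by linarith⟩

/-- The printed simplifications of instance 1: `(2+ε_ind−ε₀) − 7/2 = −3/2 + ε_ind − ε₀` and
`r + α_sf + 1 < 3/2 − ε₀ ⇔ r + α_sf < ½ − ε₀` ("i.e., `α_sf < −3/2+ε_ind`", "i.e., `r + α_sf < ½`, since ε is arbitrary").
[cite: Hintz2026, TeX l.10093 (claim under review)] -/
theorem af1330a_inst_10093_simplify (ε₀ εind r αsf : ℚ) :
    ((2 + εind - ε₀) - 7 / 2 = -3 / 2 + εind - ε₀) ∧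
      (r + αsf + 1 < 3 / 2 - ε₀ ↔ r + αsf < 1 / 2 - ε₀) := by
  refine ⟨by ring, ?_⟩
  constructor <;> intro h <;> linarith

/-- **Instance 1, variant (H l.10093, parenthesis).**  "if we only had the decay order `2−ε₀` at scf, the same
conclusions would remain valid except one would need `r + α_sf < −½`": with source scf-weight `2 − ε₀` the scf
condition becomes `r + α_sf < −½ − ε₀`.
[cite: Hintz2026, TeX l.10093; Hintz2026WavesII, eq. (13.30a) TeX l.12084 (claim under review)] -/
theorem af1330a_inst_10093_variant (ε₀ εind r αsf : ℚ)
    (htf : αsf < (2 + εind - ε₀) - 7 / 2) (hscf : r + αsf < -1 / 2 - ε₀) :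
    af1330aDelivers (2 - ε₀) (2 + εind - ε₀) (r + αsf + 1) (αsf + 2) := by
  refine ⟨(-1 / 2 - ε₀ - (r + αsf)) / 2, by linarith, by linarith, by linarith⟩

/-- **Instance 2 (H l.10585).**  Source `H^{∞,(1−ε₀, 1−2ε₀, 0)}_{b,σ}(X,μ_b)`; Hintz's target
`H^{(m;k),(r, −½−ε, 0)}_{(scbt,σ);b}(X)` "for all … ε > 0; the requirement on `r` here is that `r < −½` at the zero
section": the largest tf-order delivered is `(1−2ε₀) − 3/2 = −½ − 2ε₀` (his generic "−½−ε"), and the scf condition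
is `r < −½ − ε₀`.
[cite: Hintz2026, TeX l.10585; Hintz2026WavesII, eq. (13.30a) TeX l.12084 (claim under review)] -/
theorem af1330a_inst_10585 (ε₀ r : ℚ) (hscf : r < -1 / 2 - ε₀) :
    af1330aDelivers (1 - ε₀) (1 - 2 * ε₀) r (-1 / 2 - 2 * ε₀) := by
  refine ⟨(-1 / 2 - ε₀ - r) / 2, by linarith, by linarith, by linarith⟩

/-- Conversely the rule delivers NO tf-order above `−½ − 2ε₀` from that source, and requires `r < −½ − ε₀`
("`r < −½`") at scf — the printed requirements are also necessary within the rule.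
[cite: Hintz2026, TeX l.10585; Hintz2026WavesII, eq. (13.30a) TeX l.12084 (claim under review)] -/
theorem af1330a_inst_10585_necessary (ε₀ r Ttf : ℚ) (h : af1330aDelivers (1 - ε₀) (1 - 2 * ε₀) r Ttf) :
    Ttf ≤ -1 / 2 - 2 * ε₀ ∧ r < -1 / 2 - ε₀ := by
  obtain ⟨ε, hε, hscf, htf⟩ := h
  constructor <;> linarith

/-! ## §5 The constants of [AF] Thm 9.38(5), Thm 9.5(5), (9.16b)–(9.16c) at `n = 3`, `S̲ = ϑ = 0` -/

/-- [AF] Thm 9.38(5): kernel elements of `N_tf(P₀,e^{iθ})` lie in `𝒜^{(n−1)/2 + S̲ − ε, −β}(tf)`; the exponent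
`(n−1)/2 + S̲`. [cite: Hintz2026WavesII, Thm 9.38(5) eq. (9.114) TeX l.9509-9513 (transcription; claim under review)] -/
def kerClassTf (n : ℕ) (S : ℚ) : ℚ := ((n : ℚ) - 1) / 2 + S

/-- [AF] Thm 9.5(5): kernel elements of `P̂₀(σ)`, `σ ≠ 0`, lie in `𝒜^{1 + S̲ − ε}(X)`; the exponent `1 + S̲`.
[cite: Hintz2026WavesII, Thm 9.5(5) eq. (9.21) TeX l.8003-8007 (transcription; claim under review)] -/
def kerClassSc (S : ℚ) : ℚ := 1 + S

/-- At Hintz's values `n = 3`, `S̲ = 0` (H l.6131 "ϑ_in, ϑ_out and S̲ vanish"; H l.7697 "improves the sctf-decay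
rate α to `1 − ε`"; H l.6139 "kernel elements … of class `𝒜^{1−ε}`") both exponents are `1`, and for the
constraint-damped `□^𝓒` with `S̲ = γ^𝓒(1−e^𝓒)(1−v^𝓒)` (H l.6855) the tf-exponent is `1 + γ^𝓒(1−e^𝓒)(1−v^𝓒)`.
[cite: Hintz2026, TeX l.6131, l.6139, l.6855, l.7697; Hintz2026WavesII, Thm 9.5(5), Thm 9.38(5) (claim under review)] -/
theorem kerClass_values (γ e v : ℚ) :
    kerClassTf 3 0 = 1 ∧ kerClassSc 0 = 1 ∧
      kerClassTf 3 (γ * (1 - e) * (1 - v)) = 1 + γ * (1 - e) * (1 - v) := by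
  refine ⟨?_, ?_, ?_⟩ <;> simp only [kerClassTf, kerClassSc] <;> norm_num

/-- [AF] (9.16b): threshold at the incoming radial set `ℛ_{σ,in}`: `r_σ + α₊ > ½(−1 + ϑ_{∂𝒦⁺,in})`.
[cite: Hintz2026WavesII, eq. (9.16b) TeX l.7970-7971 (transcription; claim under review)] -/
def thrIn (ϑin : ℚ) : ℚ := (-1 + ϑin) / 2

/-- [AF] (9.16c): threshold at the outgoing radial set `ℛ_out`: `r_σ + α₊ < −½ + S̲`.
[cite: Hintz2026WavesII, eq. (9.16c) TeX l.7972-7973 (transcription; claim under review)] -/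
def thrOut (S : ℚ) : ℚ := -1 / 2 + S

/-- At `ϑ_in = S̲ = 0` both thresholds are `−½`: "at the zero section `ℛ_out` … we have `r_± < −½`, and at the
incoming radial set `ℛ_{±1,in}` … we have `r_± > −½`" (H l.6240; also l.7697, l.10585, with `α₊ = 0`, H l.6131 fn.).
An order function satisfying both must therefore DECREASE from above `−½` at `ℛ_in` to below `−½` at `ℛ_out`
(the monotonicity required at H l.6240 / AF §9.1). [cite: Hintz2026, TeX l.6240; Hintz2026WavesII, eq. (9.16b)-(9.16c) (claim under review)] -/
theorem thr_values : thrIn 0 = -1 / 2 ∧ thrOut 0 = -1 / 2 ∧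
    ∀ rin rout : ℚ, thrIn 0 < rin → rout < thrOut 0 → rout < rin := by
  refine ⟨by norm_num [thrIn], by norm_num [thrOut], ?_⟩
  intro rin rout hin hout
  simp only [thrIn, thrOut] at hin hout
  linarith

/-- The indicial-gap instantiations of [AF] Thm 9.38's hypothesis "`−q + n/2` in an indicial gap" at `n = 3`:
Hintz's "let us take `−q + 3/2 = ½`" (H l.6131) lies in the gap `(0,1)` of `□_{g_b}`, and `−q + 3/2 ∈ (0, ε_ind)`
(H l.7700) is inhabited iff `ε_ind > 0` (Lemma 8.4's `ε_ind > 0`).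
[cite: Hintz2026, TeX l.6131 and l.7700; Hintz2026WavesII, Thm 9.38 TeX l.9484 (claim under review)] -/
theorem gap_instances (εind : ℚ) :
    (-(1 : ℚ) + 3 / 2 ∈ Set.Ioo (0 : ℚ) 1) ∧ ((∃ q : ℚ, -q + 3 / 2 ∈ Set.Ioo 0 εind) ↔ 0 < εind) := by
  refine ⟨by norm_num [Set.mem_Ioo], ?_⟩
  constructor
  · rintro ⟨q, hq⟩
    rcases hq with ⟨h1, h2⟩
    linarith
  · intro h
    refine ⟨3 / 2 - εind / 2, ?_⟩
    constructor <;> linarith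

end Hintz2026.SpectralSideDictionary

end Literature.Geometry.Lorentzian
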